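import Summits.RiemannHypothesis.RiemannHypothesis.Theorems.Splittings.ZdConditionalComplements
import HarnessLib

/-!
# Splittings — the PROLIFERATION currency of the zd conditional-complement axis (zero-def raw form; part 2 of
# `ZdConditionalComplements.lean`)

Cell rh-split, seat rh-split-zd-neg gen 4 (`HOME/rh-split-zd-neg/SketchG4.lean` sha16 4b9ded8a22ffddff §3 and the two
proliferation rungs of §5; referee g2 content PASS 01:39:04Z); zero-def raw form by rh-split-typer-1 g3.  `ProlifBeyond σ₀ θ`
is SPELLED OUT: «every zero `s` of `ζ` with `σ₀ < Re s < 1` forces, at some abscissa `σ₀ < σ ≤ Re s`, a zero count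
`N(σ, T) = zetaZeroCountRe σ T` that is NOT `O(T^{θ σ})`» — RH-implied (vacuous) for every `σ₀ ≥ 1/2`
(`prolifBeyond_of_rh`).  Rows: DH pairs with every `θ(σ) > 2(1 − σ)` (`rh_of_dh_of_prolif`), LH likewise via Ingham's
`LH ⟹ DH` (`rh_of_lh_of_prolif`) and beyond `3/4` with every `θ > 0` (`quasiRH34_of_lh_of_prolif`, Halász–Turán), and
the PROVED Selberg near-line density theorem (tree `SelbergDensity.selberg_zeroDensity_near_half`) with every
`θ(σ) > 1 − κ(σ − 1/2)` UNCONDITIONALLY (`rh_of_prolif_selberg`), where the law is then literally RH-EQUIVALENT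
(`prolif_selberg_iff_rh`, `nearLine_windows`: near the line all admissible exponents tend to `1`).  Top rung: ACL pairs
with the weakest law `θ ≡ 0` (`rh_of_acl_of_prolif0`), which IS LindelofBridge's localised ZOI (`zoi_of_prolif0`).
CONDITIONAL bookkeeping; every complement RH-IMPLIED (immune); class zd×neg UNCHANGED; nothing here bears on the truth of RH.

HONEST LABEL: «SPLITTING SEARCH over kernel-typed RH-EQUIVALENCES; a splitting A ∧ B ⟹ RH is CONDITIONAL
bookkeeping unless A and B are both proved; nothing here bears on the truth of RH.»
-/

set_option linter.dupNamespace false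
set_option linter.unusedVariables false

noncomputable section

namespace Summit.RiemannHypothesis.RiemannHypothesis.Theorems.Splittings.ZdProliferationComplements

open Complex Filter Set Topology Asymptotics
open scoped Real ComplexConjugate
open Literature.NumberTheory.LFunctions
open Summit.RiemannHypothesis.RiemannHypothesis.Theses
open Summit.RiemannHypothesis.RiemannHypothesis.Theorems.Splittings
open Summit.RiemannHypothesis.RiemannHypothesis.Theorems.Splittings.ZdConditionalComplements

/-! ## §3 The PROLIFERATION currency -/

/-- Immunity of every proliferation law beyond `σ₀ ≥ 1/2`. [folklore] -/
theorem prolifBeyond_of_rh (hRH : RiemannHypothesis) {σ₀ : ℝ} (hσ₀ : 1 / 2 ≤ σ₀) (θ : ℝ → ℝ) :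
    (∀ s : ℂ, riemannZeta s = 0 → σ₀ < s.re → s.re < 1 →
      ∃ σ : ℝ, σ₀ < σ ∧ σ ≤ s.re ∧
        ¬ ((fun T : ℝ ↦ (zetaZeroCountRe σ T : ℝ)) =O[atTop] fun T : ℝ ↦ T ^ θ σ)) :=
  fun s hs h0 _ ↦ (no_zero_beyond_half_of_rh hRH hs (lt_of_le_of_lt hσ₀ h0)).elim

/-- Generic glue: a density bound `N(σ,T) = O(T^{θ(σ)})` on `(σ₀, 1)` plus proliferation with the same
exponent beyond `σ₀` gives quasi-RH(`σ₀`). [folklore] -/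
theorem quasiRH_of_density_of_prolif {σ₀ : ℝ} {θ : ℝ → ℝ}
    (hD : ∀ σ : ℝ, σ₀ < σ → σ < 1 →
      (fun T : ℝ ↦ (zetaZeroCountRe σ T : ℝ)) =O[atTop] fun T : ℝ ↦ T ^ θ σ)
    (hP : (∀ s : ℂ, riemannZeta s = 0 → σ₀ < s.re → s.re < 1 →
      ∃ σ : ℝ, σ₀ < σ ∧ σ ≤ s.re ∧
        ¬ ((fun T : ℝ ↦ (zetaZeroCountRe σ T : ℝ)) =O[atTop] fun T : ℝ ↦ T ^ θ σ))) : QuasiRiemannHypothesis σ₀ := by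
  intro s hs h0 h1
  obtain ⟨σ, hσ0, hσs, hnot⟩ := hP s hs h0 h1
  exact hnot (hD σ hσ0 (lt_of_le_of_lt hσs h1))

/-- DH in the `O(T^e)` form for any exponent `e > 2(1 − σ)`. [folklore] -/
theorem dh_isBigO (hDH : DensityHypothesis) {σ e : ℝ} (hσ : 1 / 2 ≤ σ) (hσ1 : σ ≤ 1)
    (he : 2 * (1 - σ) < e) :
    (fun T : ℝ ↦ (zetaZeroCountRe σ T : ℝ)) =O[atTop] fun T : ℝ ↦ T ^ e := by
  refine (hDH (e - 2 * (1 - σ)) (by linarith) σ hσ hσ1).congr_right fun T ↦ ?_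
  show T ^ (2 * (1 - σ) + (e - 2 * (1 - σ))) = T ^ e
  congr 1
  ring

/-- **DH row.** The density hypothesis plus ANY proliferation law with exponent `θ(σ) > 2(1 − σ)` beyond
`1/2` gives RH. The complement is RH-implied (`prolifBeyond_of_rh`), hence immune. [folklore] -/
theorem rh_of_dh_of_prolif {θ : ℝ → ℝ} (hθ : ∀ σ : ℝ, 1 / 2 < σ → σ < 1 → 2 * (1 - σ) < θ σ)
    (hDH : DensityHypothesis) (hP : (∀ s : ℂ, riemannZeta s = 0 → 1 / 2 < s.re → s.re < 1 →
      ∃ σ : ℝ, 1 / 2 < σ ∧ σ ≤ s.re ∧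
        ¬ ((fun T : ℝ ↦ (zetaZeroCountRe σ T : ℝ)) =O[atTop] fun T : ℝ ↦ T ^ θ σ))) : RiemannHypothesis :=
  quasiRiemannHypothesis_one_half_iff_holds.1 <| quasiRH_of_density_of_prolif
    (fun σ h0 h1 ↦ dh_isBigO hDH h0.le h1.le (hθ σ h0 h1)) hP

/-- **LH row, near-line part.** Via Ingham's `LH ⟹ DH` (named fact `Titchmarsh1986_sec9_18_lindelofDensity`,
bridge `DensityHypothesis.of_lindelofHypothesis` in tree): LH pairs with exactly the DH-row complements.
[folklore] -/
theorem rh_of_lh_of_prolif (h918 : Literature.Barriers.RiemannHypothesis.Titchmarsh1986_sec9_18_lindelofDensity)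
    {θ : ℝ → ℝ} (hθ : ∀ σ : ℝ, 1 / 2 < σ → σ < 1 → 2 * (1 - σ) < θ σ)
    (hLH : LindelofHypothesis) (hP : (∀ s : ℂ, riemannZeta s = 0 → 1 / 2 < s.re → s.re < 1 →
      ∃ σ : ℝ, 1 / 2 < σ ∧ σ ≤ s.re ∧
        ¬ ((fun T : ℝ ↦ (zetaZeroCountRe σ T : ℝ)) =O[atTop] fun T : ℝ ↦ T ^ θ σ))) : RiemannHypothesis :=
  rh_of_dh_of_prolif hθ (DensityHypothesis.of_lindelofHypothesis h918 hLH) hP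

/-- **LH row, beyond 3/4.** Via Halász–Turán (route LindelofBridge's `HalaszTuranSparsity`,
stmt-RiemannHypothesis-10800, a theorem in print): LH pairs with EVERY positive exponent beyond `3/4`
(«one zero beyond 3/4 forces polynomially many») — but the conclusion is only quasi-RH(3/4). [folklore] -/
theorem quasiRH34_of_lh_of_prolif (hHT : LindelofBridge.HalaszTuranSparsity) {θ : ℝ → ℝ}
    (hθ : ∀ σ : ℝ, 3 / 4 < σ → 0 < θ σ) (hLH : LindelofHypothesis) (hP : (∀ s : ℂ, riemannZeta s = 0 →
        3 / 4 < s.re → s.re < 1 →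
      ∃ σ : ℝ, 3 / 4 < σ ∧ σ ≤ s.re ∧
        ¬ ((fun T : ℝ ↦ (zetaZeroCountRe σ T : ℝ)) =O[atTop] fun T : ℝ ↦ T ^ θ σ))) :
    QuasiRiemannHypothesis (3 / 4) :=
  quasiRH_of_density_of_prolif (fun σ h0 _ ↦ hHT hLH σ h0 (θ σ) (hθ σ h0)) hP

/-- Selberg's near-line density theorem (tree theorem `SelbergDensity.selberg_zeroDensity_near_half`,
Titchmarsh Thm 9.19 (C)) in the `O(T^e)` form: `N(σ,T) = O(T^{1 − κ(σ−1/2) + ε})`. UNCONDITIONAL. [folklore] -/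
theorem selberg_isBigO : ∃ κ : ℝ, 0 < κ ∧ ∀ σ : ℝ, 1 / 2 ≤ σ → σ ≤ 1 → ∀ ε : ℝ, 0 < ε →
    (fun T : ℝ ↦ (zetaZeroCountRe σ T : ℝ)) =O[atTop] fun T : ℝ ↦ T ^ (1 - κ * (σ - 1 / 2) + ε) := by
  obtain ⟨κ, hκ, C, T₀, h⟩ := SelbergDensity.selberg_zeroDensity_near_half
  refine ⟨κ, hκ, fun σ h0 h1 ε hε ↦ ?_⟩
  set a : ℝ := 1 - κ * (σ - 1 / 2) with ha
  have h1' : (fun T : ℝ ↦ (zetaZeroCountRe σ T : ℝ)) =O[atTop]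
      fun T : ℝ ↦ C * T ^ a * Real.log T := by
    refine IsBigO.of_bound 1 ?_
    filter_upwards [eventually_ge_atTop T₀] with T hT
    rw [one_mul, Real.norm_of_nonneg (Nat.cast_nonneg _), Real.norm_eq_abs]
    exact (h T hT σ h0 h1).trans (le_abs_self _)
  have h2 : (fun T : ℝ ↦ C * T ^ a * Real.log T) =o[atTop] fun T : ℝ ↦ T ^ a * T ^ ε :=
    (isBigO_const_mul_self C (fun T : ℝ ↦ T ^ a) atTop).mul_isLittleO (isLittleO_log_rpow_atTop hε)
  refine (h1'.trans h2.isBigO).congr' EventuallyEq.rfl ?_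
  filter_upwards [eventually_gt_atTop (0 : ℝ)] with T hT
  rw [← Real.rpow_add hT]

/-- **Proved row (Selberg).** UNCONDITIONALLY: any proliferation law with exponent beating every Selberg
shape, `θ(σ) > 1 − κ(σ − 1/2)` for the tree's `κ`, gives RH on its own — so such a law is a COSTUME. [folklore] -/
theorem rh_of_prolif_selberg : ∃ κ : ℝ, 0 < κ ∧ ∀ θ : ℝ → ℝ,
    (∀ σ : ℝ, 1 / 2 < σ → σ < 1 → 1 - κ * (σ - 1 / 2) < θ σ) →
      (∀ s : ℂ, riemannZeta s = 0 → 1 / 2 < s.re → s.re < 1 →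
      ∃ σ : ℝ, 1 / 2 < σ ∧ σ ≤ s.re ∧
        ¬ ((fun T : ℝ ↦ (zetaZeroCountRe σ T : ℝ)) =O[atTop] fun T : ℝ ↦ T ^ θ σ)) → RiemannHypothesis := by
  obtain ⟨κ, hκ, hS⟩ := selberg_isBigO
  refine ⟨κ, hκ, fun θ hθ hP ↦ quasiRiemannHypothesis_one_half_iff_holds.1 <|
    quasiRH_of_density_of_prolif (fun σ h0 h1 ↦ ?_) hP⟩
  have := hS σ h0.le h1.le (θ σ - (1 - κ * (σ - 1 / 2))) (by linarith [hθ σ h0 h1])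
  refine this.congr_right fun T ↦ ?_
  congr 1
  ring

/-- … and conversely RH gives it vacuously: the Selberg-beating proliferation law is RH-EQUIVALENT. [folklore] -/
theorem prolif_selberg_iff_rh : ∃ κ : ℝ, 0 < κ ∧ ∀ θ : ℝ → ℝ,
    (∀ σ : ℝ, 1 / 2 < σ → σ < 1 → 1 - κ * (σ - 1 / 2) < θ σ) →
      ((∀ s : ℂ, riemannZeta s = 0 → 1 / 2 < s.re → s.re < 1 →
      ∃ σ : ℝ, 1 / 2 < σ ∧ σ ≤ s.re ∧
        ¬ ((fun T : ℝ ↦ (zetaZeroCountRe σ T : ℝ)) =O[atTop] fun T : ℝ ↦ T ^ θ σ)) ↔ RiemannHypothesis) := by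
  obtain ⟨κ, hκ, h⟩ := rh_of_prolif_selberg
  exact ⟨κ, hκ, fun θ hθ ↦ ⟨h θ hθ, fun hRH ↦ prolifBeyond_of_rh hRH le_rfl θ⟩⟩

/-- NEAR-LINE COLLAPSE, typed: the DH-row window and the proved-row window for the admissible exponent at
`σ = 1/2 + η` are `θ > 1 − 2η` versus `θ > 1 − κη`; both tend to `1`. Concretely, for the affine family
`θ_c(σ) = 1 − c(σ − 1/2)`: DH admits every `c < 2`, the proved theorem admits every `c < κ`, and for
`c < κ` the law `ProlifBeyond (1/2) θ_c` is already RH-equivalent. [folklore] -/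
theorem nearLine_windows : (∀ c : ℝ, c < 2 → DensityHypothesis →
      (∀ s : ℂ, riemannZeta s = 0 → 1 / 2 < s.re → s.re < 1 →
      ∃ σ : ℝ, 1 / 2 < σ ∧ σ ≤ s.re ∧
        ¬ ((fun T : ℝ ↦ (zetaZeroCountRe σ T : ℝ)) =O[atTop] fun T : ℝ ↦ T ^ (1 - c * (σ - 1 / 2)))) →
            RiemannHypothesis) ∧
    ∃ κ : ℝ, 0 < κ ∧ ∀ c : ℝ, c < κ →
      ((∀ s : ℂ, riemannZeta s = 0 → 1 / 2 < s.re → s.re < 1 →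
      ∃ σ : ℝ, 1 / 2 < σ ∧ σ ≤ s.re ∧
        ¬ ((fun T : ℝ ↦ (zetaZeroCountRe σ T : ℝ)) =O[atTop] fun T : ℝ ↦ T ^ (1 - c * (σ - 1 / 2)))) ↔
            RiemannHypothesis) := by
  refine ⟨fun c hc hDH hP ↦ rh_of_dh_of_prolif (fun σ h0 h1 ↦ by nlinarith) hDH hP, ?_⟩
  obtain ⟨κ, hκ, h⟩ := prolif_selberg_iff_rh
  exact ⟨κ, hκ, fun c hc ↦ h _ fun σ h0 h1 ↦ by nlinarith⟩

/-! ## §5 (proliferation part) The top rung `θ ≡ 0` and LindelofBridge's localised ZOI -/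

/-- **Top rung of the proliferation ladder.** With `H` = ACL (count `O(1)` beyond every `1/2 + ε`, tree
`countRe_bounded_of_acl`) the matching complement is the WEAKEST proliferation law, exponent `θ ≡ 0`
(«an off-line zero forces unboundedly many zeros beyond some fixed abscissa»). [folklore] -/
theorem rh_of_acl_of_prolif0 (hacl : RuelleBand.AsymptoticCriticalLine)
    (hP : (∀ s : ℂ, riemannZeta s = 0 → 1 / 2 < s.re → s.re < 1 →
      ∃ σ : ℝ, 1 / 2 < σ ∧ σ ≤ s.re ∧
        ¬ ((fun T : ℝ ↦ (zetaZeroCountRe σ T : ℝ)) =O[atTop] fun T : ℝ ↦ T ^ (0 : ℝ)))) : RiemannHypothesis := by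
  refine quasiRiemannHypothesis_one_half_iff_holds.1 (quasiRH_of_density_of_prolif (fun σ h0 _ ↦ ?_) hP)
  obtain ⟨C, hC⟩ :=
    Summit.RiemannHypothesis.RiemannHypothesis.Theorems.AsymptoticCriticalLine.Negative.countRe_bounded_of_acl hacl
      (by linarith : 0 < σ - 1 / 2)
  have hσ : (1 : ℝ) / 2 + (σ - 1 / 2) = σ := by ring
  rw [hσ] at hC
  refine IsBigO.of_bound C ?_
  filter_upwards [eventually_gt_atTop (0 : ℝ)] with T hT
  simp only [Real.rpow_zero, norm_one, mul_one, Real.norm_natCast]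
  exact_mod_cast hC T

/-- The `θ ≡ 0` proliferation law beyond every `σ₁ ≥ 1/2` is exactly LindelofBridge's localised ZOI: the
proliferation currency interpolates between ZOI (`θ ≡ 0`, pairs with ACL) and RH itself (`θ` beating Selberg).
[folklore] -/
theorem zoi_of_prolif0 (hP : ∀ σ₁ : ℝ, 1 / 2 ≤ σ₁ → (∀ s : ℂ, riemannZeta s = 0 → σ₁ < s.re → s.re < 1 →
      ∃ σ : ℝ, σ₁ < σ ∧ σ ≤ s.re ∧
        ¬ ((fun T : ℝ ↦ (zetaZeroCountRe σ T : ℝ)) =O[atTop] fun T : ℝ ↦ T ^ (0 : ℝ)))) :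
    LindelofBridge.ZeroOrInfinityLoc := by
  intro σ₁ hσ₁ hfin s hs h0 h1
  obtain ⟨σ, hσ0, hσs, hnot⟩ := hP σ₁ hσ₁ s hs h0 h1
  apply hnot
  -- finitely many zeros beyond `σ₁` ⟹ `N(σ, T)` bounded for `σ > σ₁` ⟹ `O(T^0)`
  have hsub : ∀ T : ℝ, zetaZeroBox σ T ⊆ {s : ℂ | riemannZeta s = 0 ∧ σ₁ < s.re} :=
    fun T z hz ↦ ⟨hz.1, lt_of_lt_of_le hσ0 hz.2.1⟩
  have hbd : ∀ T : ℝ, zetaZeroCountRe σ T ≤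
      (∑ᶠ ρ ∈ {s : ℂ | riemannZeta s = 0 ∧ σ₁ < s.re}, riemannZetaZeroOrder ρ).toNat := by
    intro T
    unfold zetaZeroCountRe
    apply Int.toNat_le_toNat
    rw [finsum_mem_eq_finite_toFinset_sum _ (hfin.subset (hsub T)),
      finsum_mem_eq_finite_toFinset_sum _ hfin]
    apply Finset.sum_le_sum_of_subset_of_nonneg
    · exact Set.Finite.toFinset_subset_toFinset.2 (hsub T)
    · intro ρ hρ _
      have hρ' : ρ ∈ {s : ℂ | riemannZeta s = 0 ∧ σ₁ < s.re} := hfin.mem_toFinset.1 hρ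
      refine riemannZetaZeroOrder_nonneg fun h ↦ ?_
      have hz := hρ'.1
      rw [h] at hz
      exact riemannZeta_ne_zero_of_one_le_re (by simp) hz
  refine IsBigO.of_bound ((∑ᶠ ρ ∈ {s : ℂ | riemannZeta s = 0 ∧ σ₁ < s.re},
    riemannZetaZeroOrder ρ).toNat : ℝ) ?_
  filter_upwards [eventually_gt_atTop (0 : ℝ)] with T hT
  simp only [Real.rpow_zero, norm_one, mul_one, Real.norm_natCast]
  exact_mod_cast hbd T

end Summit.RiemannHypothesis.RiemannHypothesis.Theorems.Splittings.ZdProliferationComplements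

end
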